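import Mathlib
import HarnessLib
import Summits.Ventures.LatticeQCDFlow.Scaling.TorusRankedMorseCount

/-!
# LatticeQCDFlow / Scaling — why `d`: the first `ℤ/2`-homology of the discrete torus `(ℤ/L)^d` has
# dimension exactly `d`, and the Morse plaquettes are a basis of the boundary space

HONEST FRAMING: exact (Metropolis-corrected) sampling algorithms for lattice gauge theory;
figures of merit are autocorrelation/cost numbers at stated couplings and volumes; no
continuum-physics claim.

Venture `LatticeQCDFlow` (cell pub-lqcd), topic `Scaling`, FANOUT row 30 (lean-1, GEN-25) — OUR WORK on
THEORY-2.md §4 row C5, the structural fact under `TorusRankedHomologyBound` ∕ `TorusRankedMorseCount`: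
the `d` in `k_min(d) = (d−1)(d−2)/2·L^d + (d−1)` is the first Betti number of the torus.  With
`∂₁ = vertex parity : (links → ℤ/2) → (sites → ℤ/2)`, the boundary vectors `∂₂ p` of the plaquettes and
the winding functionals of `TorusRankedHomologyBound` (`L ≥ 2`):

* §1 **`finrank_range_vertexParity`** — `rank ∂₁ = #sites − 1` EXACTLY (`≥`: lattice paths,
  `TorusRankedParityBound`; `≤`: the range lies in the kernel of the total-parity functional, which is
  onto `ℤ/2`);
* §2 **`le_finrank_range_parityWinding`** — `rank (∂₁, winding) ≥ #sites − 1 + d` (the paths and the `d`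
  straight lines), hence **`finrank_span_boundaryVec_le`**: the span of ALL plaquette boundaries has
  dimension `≤ #links + 1 − #sites − d = (d−1)(L^d − 1)`;
* §3 **`finrank_span_boundaryVec`** — `= (d−1)(L^d − 1)` EXACTLY: the boundaries of the Morse structure
  (`TorusRankedMorseStructure`, `(d−1)(L^d − 1)` of them, independent because ranked) lie in it; and
  **`span_boundaryVec_morse_eq`** — THE MORSE PLAQUETTES' BOUNDARIES SPAN EVERY PLAQUETTE BOUNDARY (a
  basis of the boundary space `B₁`);
* §4 **`finrank_ker_vertexParity_eq`** — `dim ker ∂₁ = dim B₁ + d`: the first homology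
  `ker ∂₁ / B₁` of the cubulated `d`-torus over `ℤ/2` has dimension exactly `d`, which is why exactly `d`
  enters the count of plaquettes every exact one-plaquette heat-bath autoregression must leave outside.

No `def` (maps are spelled out as terms), no `sorry`, nothing cited as a fact beyond the tree.
-/

namespace Summit.Ventures.LatticeQCDFlow.Theory2.Autoregressive

open Finset
open Literature.MathematicalPhysics.QuantumFieldTheory

variable {d L : ℕ} [NeZero L]

/-! ## §1 The rank of the vertex-parity map is exactly `#sites − 1` -/

/-- The total-parity functional `g ↦ Σ_y g y` is linear and kills the vertex parity of every `f`
(each link contributes its value twice). [ours] -/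
theorem sum_vertexParity_eq_zero (f : Edge d L → ZMod 2) :
    ∑ y : Site d L, ∑ i : Fin d, (f (y, i) + f (y - Pi.single i 1, i)) = 0 := by
  rw [Finset.sum_comm]
  refine Finset.sum_eq_zero fun i _ => ?_
  rw [Finset.sum_add_distrib]
  have hre : ∑ y : Site d L, f (y - Pi.single i 1, i) = ∑ y : Site d L, f (y, i) :=
    Fintype.sum_equiv (Equiv.subRight (Pi.single i (1 : ZMod L))) _ _ (fun y => rfl)
  rw [hre]
  have key : ∀ a : ZMod 2, a + a = 0 := by decide
  rw [← Finset.sum_add_distrib]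
  exact Finset.sum_eq_zero fun y _ => key _

/-- **`rank ∂₁ = #sites − 1` exactly** (`TorusRankedParityBound` gave `≥`; the range lies in the kernel of the
total parity, a non-zero functional). [ours] -/
theorem finrank_range_vertexParity :
    Module.finrank (ZMod 2) (LinearMap.range ((vertexParity_isLinear (d := d) (L := L)).mk')) + 1 =
      Fintype.card (Site d L) := by
  classical
  have hge := card_site_le_finrank_range_vertexParity_add_one (d := d) (L := L)
  -- the total-parity functional
  set σ : (Site d L → ZMod 2) →ₗ[ZMod 2] ZMod 2 :=
    { toFun := fun g => ∑ y, g y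
      map_add' := fun g h => by simp [Finset.sum_add_distrib]
      map_smul' := fun c g => by simp [Finset.mul_sum] } with hσ
  have hsub : LinearMap.range ((vertexParity_isLinear (d := d) (L := L)).mk') ≤ LinearMap.ker σ := by
    rintro g ⟨f, rfl⟩
    simp only [LinearMap.mem_ker, hσ, LinearMap.coe_mk, AddHom.coe_mk, IsLinearMap.mk'_apply]
    exact sum_vertexParity_eq_zero f
  have hσsurj : Function.Surjective σ := by
    intro c
    refine ⟨Pi.single 0 c, ?_⟩
    simp [hσ]
  have hrank : Module.finrank (ZMod 2) (LinearMap.range σ) = 1 := by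
    rw [LinearMap.range_eq_top.2 hσsurj, finrank_top, Module.finrank_self]
  have hrn := LinearMap.finrank_range_add_finrank_ker σ
  have hV : Module.finrank (ZMod 2) (Site d L → ZMod 2) = Fintype.card (Site d L) :=
    Module.finrank_fintype_fun_eq_card _
  have hle := Submodule.finrank_mono hsub
  omega

/-! ## §2 The span of all plaquette boundaries has dimension at most `(d−1)(L^d − 1)` -/

/-- **`rank (∂₁, winding) ≥ #sites − 1 + d`**: the images of the lattice paths `(𝟙_0 + 𝟙_y, ·)`, `y ≠ 0`, and of
the straight lines `(0, 𝟙_n)` are independent (the argument inside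
`TorusRankedHomologyBound.card_add_card_site_add_le_card_edge_add_one_of_ranked`, recorded as a lemma).
[ours] -/
theorem le_finrank_range_parityWinding :
    Fintype.card (Site d L) - 1 + d ≤ Module.finrank (ZMod 2) (LinearMap.range
      (((vertexParity_isLinear (d := d) (L := L)).mk').prod ((winding_isLinear (d := d) (L := L)).mk'))) := by
  classical
  set V : (Edge d L → ZMod 2) →ₗ[ZMod 2] (Site d L → ZMod 2) :=
    (vertexParity_isLinear (d := d) (L := L)).mk' with hV
  set W : (Edge d L → ZMod 2) →ₗ[ZMod 2] (Fin d → ZMod 2) :=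
    (winding_isLinear (d := d) (L := L)).mk' with hW
  set ψ := V.prod W with hψ
  have hψapply : ∀ f, ψ f = (V f, W f) := fun f => rfl
  have hpath : ∀ y : Site d L, ∃ f : Edge d L → ZMod 2,
      V f = (Pi.single 0 1 + Pi.single y 1 : Site d L → ZMod 2) := by
    intro y
    obtain ⟨f, hf⟩ := (LinearMap.mem_range).1
      (single_zero_add_single_mem_range_vertexParity (d := d) (L := L) y)
    exact ⟨f, hf⟩
  choose path hpath using hpath
  have hVline : ∀ n : Fin d,
      V (∑ c : ZMod L, (Pi.single ((Pi.single n c : Site d L), n) 1 : Edge d L → ZMod 2)) = 0 :=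
    fun n => vertexParity_line n
  have hWline : ∀ n : Fin d,
      W (∑ c : ZMod L, (Pi.single ((Pi.single n c : Site d L), n) 1 : Edge d L → ZMod 2)) =
        Pi.single n 1 :=
    fun n => winding_line n
  set v : {y : Site d L // y ≠ 0} ⊕ Fin d → (Site d L → ZMod 2) × (Fin d → ZMod 2) :=
    Sum.elim (fun y : {y : Site d L // y ≠ 0} => ψ (path (y : Site d L)))
      (fun n : Fin d => ψ (∑ c : ZMod L, (Pi.single ((Pi.single n c : Site d L), n) 1 : Edge d L → ZMod 2)))
    with hv
  have hvmem : ∀ s, v s ∈ LinearMap.range ψ := by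
    rintro (y | n)
    · rw [hv, Sum.elim_inl]; exact LinearMap.mem_range_self ψ _
    · rw [hv, Sum.elim_inr]; exact LinearMap.mem_range_self ψ _
  have hvl : ∀ y : {y : Site d L // y ≠ 0},
      v (Sum.inl y) = ((Pi.single 0 1 + Pi.single (y : Site d L) 1 : Site d L → ZMod 2), W (path y)) := by
    intro y
    rw [hv, Sum.elim_inl, hψapply, hpath]
  have hvr : ∀ n : Fin d, v (Sum.inr n) = ((0 : Site d L → ZMod 2), (Pi.single n 1 : Fin d → ZMod 2)) := by
    intro n
    rw [hv, Sum.elim_inr, hψapply, hVline, hWline]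
  have hli : LinearIndependent (ZMod 2) (fun s => (⟨v s, hvmem s⟩ : LinearMap.range ψ)) := by
    apply LinearIndependent.of_comp (LinearMap.range ψ).subtype
    rw [Fintype.linearIndependent_iff]
    intro g hg
    simp only [Function.comp_apply, Submodule.coe_subtype, Fintype.sum_sum_type, hvl, hvr] at hg
    have hfst := congrArg Prod.fst hg
    simp only [Prod.fst_add, Prod.fst_sum, Prod.smul_fst, smul_zero, Finset.sum_const_zero, add_zero,
      Prod.fst_zero] at hfst
    have hgl : ∀ y : {y : Site d L // y ≠ 0}, g (Sum.inl y) = 0 := by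
      intro y
      have heval := congrArg (fun f : Site d L → ZMod 2 => f (y : Site d L)) hfst
      simp only [Finset.sum_apply, Pi.smul_apply, Pi.add_apply, smul_eq_mul, Pi.zero_apply] at heval
      rw [Finset.sum_eq_single y] at heval
      · have hy0 : (Pi.single (0 : Site d L) (1 : ZMod 2) : Site d L → ZMod 2) (y : Site d L) = 0 := by
          simp [y.2]
        rw [hy0, zero_add] at heval
        simpa using heval
      · intro y' _ hy'
        have e1 : (Pi.single (0 : Site d L) (1 : ZMod 2) : Site d L → ZMod 2) (y : Site d L) = 0 := by
          simp [y.2]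
        have e2 : (Pi.single (y' : Site d L) (1 : ZMod 2) : Site d L → ZMod 2) (y : Site d L) = 0 := by
          have : (y : Site d L) ≠ (y' : Site d L) := fun h => hy' (Subtype.ext h).symm
          simp [this]
        rw [e1, e2, add_zero, mul_zero]
      · intro h; exact absurd (Finset.mem_univ y) h
    have hsnd := congrArg Prod.snd hg
    simp only [Prod.snd_sum, Prod.smul_snd, hgl, zero_smul, Finset.sum_const_zero, zero_add,
      Prod.snd_zero] at hsnd
    have hgr : ∀ n : Fin d, g (Sum.inr n) = 0 := by
      intro n
      have heval := congrArg (fun f : Fin d → ZMod 2 => f n) hsnd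
      simp only [Finset.sum_apply, Pi.smul_apply, smul_eq_mul, Pi.zero_apply] at heval
      rw [Finset.sum_eq_single n] at heval
      · simpa using heval
      · intro n' _ hn'
        have : n ≠ n' := fun h => hn' h.symm
        simp [this]
      · intro h; exact absurd (Finset.mem_univ n) h
    rintro (y | n)
    · exact hgl y
    · exact hgr n
  have h2 := hli.fintype_card_le_finrank
  have hcard : Fintype.card ({y : Site d L // y ≠ 0} ⊕ Fin d) = Fintype.card (Site d L) - 1 + d := by
    rw [Fintype.card_sum, Fintype.card_subtype_compl, Fintype.card_subtype_eq, Fintype.card_fin]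
  rw [hcard] at h2
  exact h2

/-- **The span of ALL plaquette boundaries of `(ℤ/L)^d` has dimension `≤ #links + 1 − #sites − d`**: it lies
in the kernel of `(∂₁, winding)`. [ours] -/
theorem finrank_span_boundaryVec_add_le :
    Module.finrank (ZMod 2) (Submodule.span (ZMod 2) (Set.range fun p : Plaquette d L =>
      (Pi.single (p.1, p.2.1.1) 1 + Pi.single (p.1.shift p.2.1.1, p.2.1.2) 1 +
        Pi.single (p.1.shift p.2.1.2, p.2.1.1) 1 + Pi.single (p.1, p.2.1.2) 1 : Edge d L → ZMod 2))) +
      Fintype.card (Site d L) + d ≤ Fintype.card (Edge d L) + 1 := by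
  classical
  set ψ := ((vertexParity_isLinear (d := d) (L := L)).mk').prod ((winding_isLinear (d := d) (L := L)).mk')
    with hψ
  have hψapply : ∀ f, ψ f = (((vertexParity_isLinear (d := d) (L := L)).mk') f,
      ((winding_isLinear (d := d) (L := L)).mk') f) := fun f => rfl
  have hsub : Submodule.span (ZMod 2) (Set.range fun p : Plaquette d L =>
      (Pi.single (p.1, p.2.1.1) 1 + Pi.single (p.1.shift p.2.1.1, p.2.1.2) 1 +
        Pi.single (p.1.shift p.2.1.2, p.2.1.1) 1 + Pi.single (p.1, p.2.1.2) 1 : Edge d L → ZMod 2)) ≤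
      LinearMap.ker ψ := by
    rw [Submodule.span_le]
    rintro _ ⟨p, rfl⟩
    rw [SetLike.mem_coe, LinearMap.mem_ker, hψapply, Prod.mk_eq_zero, IsLinearMap.mk'_apply,
      IsLinearMap.mk'_apply]
    exact ⟨vertexParity_boundaryVec p, funext fun m => winding_boundaryVec p m⟩
  have hle := Submodule.finrank_mono hsub
  have h2 : Fintype.card (Site d L) - 1 + d ≤ Module.finrank (ZMod 2) (LinearMap.range ψ) :=
    le_finrank_range_parityWinding (d := d) (L := L)
  have h3 := LinearMap.finrank_range_add_finrank_ker ψ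
  have h4 : Module.finrank (ZMod 2) (Edge d L → ZMod 2) = Fintype.card (Edge d L) :=
    Module.finrank_fintype_fun_eq_card _
  have hpos : 1 ≤ Fintype.card (Site d L) := Fintype.card_pos
  omega

/-! ## §3 The Morse boundaries are a basis of the boundary space -/

/-- **The span of all plaquette boundaries has dimension EXACTLY `(d−1)(L^d − 1)`** (`L ≥ 2`): `≤` by §2,
`≥` because the `(d−1)(L^d − 1)` boundaries of the ranked Morse structure are independent
(`linearIndependent_boundaryVec_of_ranked`) and lie in it. [ours] -/
theorem finrank_span_boundaryVec (hL : 2 ≤ L) :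
    Module.finrank (ZMod 2) (Submodule.span (ZMod 2) (Set.range fun p : Plaquette d L =>
      (Pi.single (p.1, p.2.1.1) 1 + Pi.single (p.1.shift p.2.1.1, p.2.1.2) 1 +
        Pi.single (p.1.shift p.2.1.2, p.2.1.1) 1 + Pi.single (p.1, p.2.1.2) 1 : Edge d L → ZMod 2))) =
      (d - 1) * (L ^ d - 1) := by
  classical
  set S := Submodule.span (ZMod 2) (Set.range fun p : Plaquette d L =>
      (Pi.single (p.1, p.2.1.1) 1 + Pi.single (p.1.shift p.2.1.1, p.2.1.2) 1 +
        Pi.single (p.1.shift p.2.1.2, p.2.1.1) 1 + Pi.single (p.1, p.2.1.2) 1 : Edge d L → ZMod 2)) with hS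
  -- upper bound
  have hup := finrank_span_boundaryVec_add_le (d := d) (L := L)
  rw [← hS, Summit.Ventures.LatticeQCDFlow.Runbook.card_site,
    Summit.Ventures.LatticeQCDFlow.Runbook.card_edge] at hup
  -- lower bound: the Morse family
  obtain ⟨B, t, rank, -, ht, hrank, -, hB⟩ := exists_ranked_card_compl_eq (d := d) hL
  have hli := linearIndependent_boundaryVec_of_ranked hL B t ht rank hrank
  have hmem : ∀ p : B,
      (Pi.single ((p : Plaquette d L).1, (p : Plaquette d L).2.1.1) 1 +
        Pi.single ((p : Plaquette d L).1.shift (p : Plaquette d L).2.1.1, (p : Plaquette d L).2.1.2) 1 +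
        Pi.single ((p : Plaquette d L).1.shift (p : Plaquette d L).2.1.2, (p : Plaquette d L).2.1.1) 1 +
        Pi.single ((p : Plaquette d L).1, (p : Plaquette d L).2.1.2) 1 : Edge d L → ZMod 2) ∈ S :=
    fun p => Submodule.subset_span ⟨(p : Plaquette d L), rfl⟩
  have hliS : LinearIndependent (ZMod 2) (fun p : B => (⟨_, hmem p⟩ : S)) := by
    apply LinearIndependent.of_comp S.subtype
    exact hli
  have hlow := hliS.fintype_card_le_finrank
  rw [Fintype.card_coe, hB] at hlow
  -- `#links + 1 − #sites − d = (d−1)(L^d − 1)`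
  have hX : 1 ≤ L ^ d := Nat.one_le_pow _ _ (by omega)
  rcases Nat.eq_zero_or_pos d with hd | hd
  · subst hd
    simp only [pow_zero, mul_zero, Nat.zero_sub, zero_mul] at hup hlow ⊢
    omega
  · obtain ⟨Y, hY⟩ : ∃ Y, L ^ d = Y + 1 := ⟨L ^ d - 1, by omega⟩
    rw [hY] at hup hlow ⊢
    rw [Nat.add_sub_cancel] at hlow ⊢
    obtain ⟨e, rfl⟩ : ∃ e, d = e + 1 := ⟨d - 1, by omega⟩
    rw [Nat.add_sub_cancel] at hlow ⊢
    have h5 : (Y + 1) * (e + 1) = e * Y + Y + e + 1 := by ring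
    rw [h5] at hup
    nlinarith [hup, hlow]

/-- **THE MORSE PLAQUETTES' BOUNDARIES SPAN EVERY PLAQUETTE BOUNDARY** (`L ≥ 2`): for the Morse structure
`B` of `TorusRankedMorseStructure` (any ranked structure with `#B = (d−1)(L^d − 1)` would do), the span of
its boundary vectors is the whole boundary space — a basis of `B₁((ℤ/L)^d; ℤ/2)` indexed by plaquettes
and peelable along the rank. [ours] -/
theorem span_boundaryVec_eq_of_ranked_card (hL : 2 ≤ L) (B : Finset (Plaquette d L))
    (t : Plaquette d L → Edge d L)
    (ht : ∀ p ∈ B, t p ∈ ({(p.1, p.2.1.1), (p.1.shift p.2.1.1, p.2.1.2),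
        (p.1.shift p.2.1.2, p.2.1.1), (p.1, p.2.1.2)} : Finset (Edge d L)))
    (rank : Plaquette d L → ℕ)
    (hrank : ∀ p ∈ B, ∀ p' ∈ B, p ≠ p' → t p ∈ ({(p'.1, p'.2.1.1), (p'.1.shift p'.2.1.1, p'.2.1.2),
        (p'.1.shift p'.2.1.2, p'.2.1.1), (p'.1, p'.2.1.2)} : Finset (Edge d L)) → rank p < rank p')
    (hcard : B.card = (d - 1) * (L ^ d - 1)) :
    Submodule.span (ZMod 2) (Set.range fun p : B =>
      (Pi.single ((p : Plaquette d L).1, (p : Plaquette d L).2.1.1) 1 +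
        Pi.single ((p : Plaquette d L).1.shift (p : Plaquette d L).2.1.1, (p : Plaquette d L).2.1.2) 1 +
        Pi.single ((p : Plaquette d L).1.shift (p : Plaquette d L).2.1.2, (p : Plaquette d L).2.1.1) 1 +
        Pi.single ((p : Plaquette d L).1, (p : Plaquette d L).2.1.2) 1 : Edge d L → ZMod 2)) =
    Submodule.span (ZMod 2) (Set.range fun p : Plaquette d L =>
      (Pi.single (p.1, p.2.1.1) 1 + Pi.single (p.1.shift p.2.1.1, p.2.1.2) 1 +
        Pi.single (p.1.shift p.2.1.2, p.2.1.1) 1 + Pi.single (p.1, p.2.1.2) 1 : Edge d L → ZMod 2)) := by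
  classical
  apply Submodule.eq_of_le_of_finrank_le
  · rw [Submodule.span_le]
    rintro _ ⟨p, rfl⟩
    exact Submodule.subset_span ⟨(p : Plaquette d L), rfl⟩
  · rw [finrank_span_boundaryVec hL, ← hcard]
    have hli := linearIndependent_boundaryVec_of_ranked hL B t ht rank hrank
    rw [finrank_span_eq_card hli, Fintype.card_coe]

/-! ## §4 The first homology has dimension `d` -/

/-- **`dim ker ∂₁ = dim B₁ + d`**: the first `ℤ/2`-homology `ker ∂₁ / B₁` of the cubulated torus `(ℤ/L)^d`
(`L ≥ 2`) has dimension exactly `d` — `dim ker ∂₁ = #links − (#sites − 1)` (§1) and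
`dim B₁ = (d−1)(L^d − 1) = #links − #sites + 1 − d` (§3). [ours] -/
theorem finrank_ker_vertexParity_eq (hL : 2 ≤ L) :
    Module.finrank (ZMod 2) (LinearMap.ker ((vertexParity_isLinear (d := d) (L := L)).mk')) =
      Module.finrank (ZMod 2) (Submodule.span (ZMod 2) (Set.range fun p : Plaquette d L =>
        (Pi.single (p.1, p.2.1.1) 1 + Pi.single (p.1.shift p.2.1.1, p.2.1.2) 1 +
          Pi.single (p.1.shift p.2.1.2, p.2.1.1) 1 + Pi.single (p.1, p.2.1.2) 1 : Edge d L → ZMod 2))) + d := by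
  have h1 := finrank_range_vertexParity (d := d) (L := L)
  have h2 := finrank_span_boundaryVec (d := d) hL
  have h3 := LinearMap.finrank_range_add_finrank_ker ((vertexParity_isLinear (d := d) (L := L)).mk')
  have h4 : Module.finrank (ZMod 2) (Edge d L → ZMod 2) = Fintype.card (Edge d L) :=
    Module.finrank_fintype_fun_eq_card _
  rw [Summit.Ventures.LatticeQCDFlow.Runbook.card_site] at h1
  rw [Summit.Ventures.LatticeQCDFlow.Runbook.card_edge] at h4
  rw [h2]
  have hX : 1 ≤ L ^ d := Nat.one_le_pow _ _ (by omega)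
  rcases Nat.eq_zero_or_pos d with hd | hd
  · subst hd
    simp only [pow_zero, mul_zero, Nat.zero_sub, zero_mul, add_zero] at h1 h4 ⊢
    omega
  · obtain ⟨Y, hY⟩ : ∃ Y, L ^ d = Y + 1 := ⟨L ^ d - 1, by omega⟩
    rw [hY] at h1 h4 ⊢
    rw [Nat.add_sub_cancel]
    obtain ⟨e, rfl⟩ : ∃ e, d = e + 1 := ⟨d - 1, by omega⟩
    rw [Nat.add_sub_cancel]
    have h5 : (Y + 1) * (e + 1) = e * Y + Y + e + 1 := by ring
    rw [h5] at h4
    have h6 : e * (Y + 1 - 1) = e * Y := by rw [Nat.add_sub_cancel]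
    nlinarith [h1, h3, h4]

end Summit.Ventures.LatticeQCDFlow.Theory2.Autoregressive
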